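import Summits.Langlands.Langlands.Statement
import Literature.NumberTheory.DiophantineGeometry.BcgpResiduallyA5bModular
import Literature.NumberTheory.Automorphic.IsAutomorphicAE
import HarnessLib

/-!
# F3 `_special` — the floor is LITERALLY the family at `g = 2` (line `AbelianThreefoldPotentialAutomorphy`, crux
`ReciprocityUpToIrreducibility`, item stmt-Langlands-14328; G4 ladder-down generation 31)

`floor_two : FloorText → PotentiallyAutomorphicAbelianVarietyTR 2`, where `FloorText` is VERBATIM the body of the named fact
`Literature.NumberTheory.Automorphic.bcgp2021_potentiallyAutomorphic_abelianSurface` (Boxer–Calegari–Gee–Pilloni 2021,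
Thm. 1.1.3: "let `F` be totally real and `A/F` an abelian surface; then `R_A` is potentially automorphic"; arXiv:1812.09269,
Def. 9.1.1 / text Def. 363, 367; proposed by this unit as p214362 — once it is in the tree, `FloorText` is that constant by
`Iff.rfl`).  The member `g = 2` of the family carries MORE hypotheses than the fact (irreducible, a.e. unramified, de Rham) and the
same conclusion up to unfolding `Summit.Langlands.SatakeFrobCompatibleAt`; so the floor is an instance of the family by
specialisation of the dial, with no appeal to the summit.  rc 0, no `sorry`.
-/

noncomputable section

set_option linter.dupNamespace false
open scoped MatrixGroups Matrix NumberField Classical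
open Filter IsDedekindDomain IsDedekindDomain.HeightOneSpectrum CategoryTheory
open Literature.NumberTheory.Automorphic Literature.NumberTheory.GaloisRepresentations
open Literature.NumberTheory.PAdicHodge Literature.NumberTheory.DiophantineGeometry
open Literature.AlgebraicGeometry.Motives (AbelianVariety)
open NumberField
open Summit.Langlands

namespace Summit.Langlands.Langlands.Cruxes.ReciprocityUpToIrreducibility.AbelianThreefoldPotentialAutomorphy

/-! ## 1. Vocabulary: framed duals of Tate modules, potential automorphy, the family -/

/-- `r` is the framed dual of `V_ℓ(A)` in the dual basis of `b` (verbatim the clause of the BCGP / FLS facts):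
`r(γ) = [γ⁻¹]_bᵀ`, i.e. `H¹_ét(A_{K̄}, ℚ_ℓ) ⊗ ℚ̄_ℓ` framed. -/
def IsFramedDualTate {K : Type} [Field K] [NumberField K] (A : AbelianVariety K) (ℓ : ℕ) [Fact ℓ.Prime]
    {m : ℕ} (b : Module.Basis (Fin m) ℚ_[ℓ] (A.rationalTateModule ℓ))
    (r : FramedGaloisRep K (PadicAlgCl ℓ) m) : Prop :=
  ∀ g : Field.absoluteGaloisGroup K,
    (r g).val = ((LinearMap.toMatrix b b (A.rationalTateRep ℓ g⁻¹)).map (algebraMap ℚ_[ℓ] (PadicAlgCl ℓ))).transpose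

/-- **`r` is potentially automorphic (via `ι`)** — BCGP 2021, Def. 9.1.1 and §9.1 ("there is a finite extension of number
fields `L/K` such that `𝓡|_{G_L}` is automorphic"; Galois in Thm. 1.1.3), read in the summit's almost-everywhere vocabulary:
there are a finite Galois extension `L/K`, the compactness input for `GL_m` over `L`, and an `L`-algebraic AUTOMORPHIC (not
asserted cuspidal: an isobaric sum is allowed, as in print) representation `P` of `GL_m(𝔸_L)` that is Satake–Frobenius
compatible with `r|_{Γ_L}` (`FramedGaloisRep.restrictField`) at all but finitely many places of `L`. -/
def IsPotentiallyAutomorphic (K : Type) [Field K] [NumberField K] (ℓ : ℕ) [Fact ℓ.Prime] {m : ℕ}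
    (ι : PadicAlgCl ℓ ≃+* ℂ) (r : FramedGaloisRep K (PadicAlgCl ℓ) m) : Prop :=
  ∃ (L : Type) (_ : Field L) (_ : NumberField L) (_ : Algebra K L) (_ : IsGalois K L)
    (hcpt : isCompact_glFiniteIntegralLevel m L) (P : AutomorphicRepData (AutomorphyDatum.gl m L hcpt)),
    P.IsLAlgebraic ∧ ∀ᶠ w : HeightOneSpectrum (𝓞 L) in cofinite, SatakeFrobCompatibleAt ι P (r.restrictField L) w

/-- **THE RUNG FAMILY, dial = the dimension `g = dim A`.**  For every totally real `K`, every abelian variety `A/K` of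
dimension `g`, every prime `ℓ`, every framed dual `r : Γ_K → GL_{2g}(ℚ̄_ℓ)` of `V_ℓ(A)` which is irreducible, a.e. unramified
and de Rham above `ℓ` (Fontaine's pinned datum `fontainePstAdicCompletion`), and every `ι`: `r` is potentially automorphic. -/
def PotentiallyAutomorphicAbelianVarietyTR (g : ℕ) : Prop :=
  ∀ (K : Type) [Field K] [NumberField K] [IsTotallyReal K] (A : AbelianVariety K), A.dim = g →
    ∀ (ℓ : ℕ) [Fact ℓ.Prime] (b : Module.Basis (Fin (2 * g)) ℚ_[ℓ] (A.rationalTateModule ℓ))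
      (r : FramedGaloisRep K (PadicAlgCl ℓ) (2 * g)), IsFramedDualTate A ℓ b r →
      r.toGaloisRep.IsIrreducible →
      (∀ᶠ v : HeightOneSpectrum (𝓞 K) in cofinite, r.IsUnramifiedAt v) →
      (∀ (w : HeightOneSpectrum (𝓞 K)) (hw : ((ℓ : ℕ) : 𝓞 K) ∈ w.asIdeal),
          (fontainePstAdicCompletion w ℓ hw).IsDeRhamFramed (r.toLocal w)) →
      ∀ ι : PadicAlgCl ℓ ≃+* ℂ, IsPotentiallyAutomorphic K ℓ ι r

/-- **THE RUNG (θ31 = 3)**: abelian THREEFOLDS over totally real fields are potentially automorphic. -/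
-- @[stub "AbelianThreefoldPotentialAutomorphy"]
def AbelianThreefoldPotentialAutomorphy : Prop := PotentiallyAutomorphicAbelianVarietyTR 3

/-- **Above the rung (θ31 ≥ 4)**: abelian varieties of every dimension `≥ 4` over totally real fields. -/
-- @[stub "AbelianThreefoldPotentialAutomorphy"]
def HigherGenusPotentialAutomorphy : Prop := ∀ g : ℕ, 4 ≤ g → PotentiallyAutomorphicAbelianVarietyTR g

/-- **Floor text** (obligation node): the member `g = 2` as printed — Boxer–Calegari–Gee–Pilloni 2021, Thm. 1.1.3, in
abelian-variety / `GL₄` a.e.-Satake form; this is VERBATIM the body of the named fact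
`Literature.NumberTheory.Automorphic.bcgp2021_potentiallyAutomorphic_abelianSurface` (p214362, vendored by this unit; in print,
XL to discharge in the tree). [cite: BoxerEtAl2021, Thm. 1.1.3] -/
-- @[stub "AbelianThreefoldPotentialAutomorphy"]
def FloorText : Prop :=
  ∀ (F : Type) [Field F] [NumberField F] [IsTotallyReal F] (A : AbelianVariety F), A.dim = 2 →
    ∀ (ℓ : ℕ) [Fact ℓ.Prime] (b : Module.Basis (Fin 4) ℚ_[ℓ] (A.rationalTateModule ℓ))
      (r : FramedGaloisRep F (PadicAlgCl ℓ) 4),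
      (∀ g : Field.absoluteGaloisGroup F,
        (r g).val =
          ((LinearMap.toMatrix b b (A.rationalTateRep ℓ g⁻¹)).map
            (algebraMap ℚ_[ℓ] (PadicAlgCl ℓ))).transpose) →
      ∀ (ι : PadicAlgCl ℓ ≃+* ℂ),
        ∃ (L : Type) (_ : Field L) (_ : NumberField L) (_ : Algebra F L) (_ : IsGalois F L)
          (hcpt : isCompact_glFiniteIntegralLevel 4 L) (P : AutomorphicRepData (AutomorphyDatum.gl 4 L hcpt)),
          P.IsLAlgebraic ∧
            ∀ᶠ w : HeightOneSpectrum (𝓞 L) in Filter.cofinite, ∃ a : Multiset ℂ,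
              P.HasSatakeParamAt w a ∧ (r.restrictField L).IsUnramifiedAt w ∧
                (r.restrictField L).HasFrobCharpolyAt w (arithFrobPolyOfSatake ι w.residueCard 1 a)


/-! ## The floor member, sorry-free -/

/-- **F3: the family at `g = 2` from the floor fact** (BCGP 2021 Thm. 1.1.3, AV form): the irreducibility, ramification and
de Rham hypotheses of the member are simply not used; the conclusions agree definitionally. -/
theorem floor_two (h : FloorText) : PotentiallyAutomorphicAbelianVarietyTR 2 := by
  intro K _ _ _ A hdim ℓ _ b r hfr _hirr _hunr _hdR ι
  obtain ⟨L, _, _, _, _, hcpt, P, hL, hsat⟩ := h K A hdim ℓ b r hfr ι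
  exact ⟨L, inferInstance, inferInstance, inferInstance, inferInstance, hcpt, P, hL, hsat⟩

/-- The members with `2 ≤ g < 3` are exactly the floor. -/
theorem family_two (h : FloorText) (g : ℕ) (hg : 2 ≤ g) (hg' : g < 3) : PotentiallyAutomorphicAbelianVarietyTR g := by
  interval_cases g
  exact floor_two h

end Summit.Langlands.Langlands.Cruxes.ReciprocityUpToIrreducibility.AbelianThreefoldPotentialAutomorphy

end
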